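import Literature.Algebra.EuclideanLattices.BabaiIntBackSub
import Literature.Computability.QuantumComplexity.GramSchmidtRounding
import HarnessLib

/-!
# Babai's residual as a list program on Cohen's integer Gram–Schmidt table

Topic `Algebra/EuclideanLattices` (family `pqc`), sequel of `BabaiIntBackSub.lean` (`Babai.intBackSub` on
Cohen's data of the extended family `(b, w)` IS the integer nearest-plane algorithm) and of
`GramSchmidtTableLists.lean` / `Computability/QuantumComplexity/GramSchmidtRounding.lean` (Cohen's table
as the list program `tableRec`/`dList`, agreeing with `LLLIntegral.uRec`/`dRec` on `ofFn` rows: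
`tabEntry_tableRec_ofFn`, `dList_ofFn`). Everything is PROVED; definitions with bodies; no named fact.

The machine of the first component of Peikert's `GapSVP → LWE` reduction (`Cryptography/PeikertReduction.lean`,
pqc.S20) hands the BDD solver the target `x = w - ∑ zᵢbᵢ`, `z` = Babai's coefficients of the perturbation
`w` with respect to the (scaled) basis rows. On the machine everything is a LIST of integers; this file
is the list program and its agreement with the `Fin`-indexed mathematics:

* `Babai.backSubL k lamB lamW d` — back-substitution on `ℕ`-indexed data, output `[z₀, …, z_{k-1}]`;
  `backSubL_eq_ofFn_intBackSub` — it lists `Babai.intBackSub`;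
* `Babai.coeffsL rows w` — the coefficients read off ONE table of the extended rows `rows ++ [w]`
  (`lamB i j = T_j(i, j)`, `lamW j = T_j(n, j)`, `d j = d_{j+1}`, `n = |rows|` columns, `n + 1` levels);
* `Babai.residualL rows w m = [w_t - ∑ᵢ zᵢ rows[i]_t | t < m]`;
* **`coeffsL_ofFn`**, **`residualL_ofFn`** — on `ofFn` rows of a linearly independent integer family
  `b : Fin n → ℤᵐ` and `w : ℤᵐ`: `coeffsL = ofFn (intNearestPlane n b w)` and
  `residualL = ofFn (intResidual b w)` — so, read in `ℝᵐ`, the program's output is `Babai.residual`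
  (`intVecToEuclidean_intResidual`), lattice-invariant (`residual_add_of_mem_span`) and short
  (`norm_residual_le`).

## References

* L. Babai, *On Lovász' lattice reduction and the nearest lattice point problem*, Combinatorica 6 (1986)
  1–13, §3 [Babai1986].
* H. Cohen, *A Course in Computational Algebraic Number Theory*, GTM 138, Springer 1993, Algorithm 2.6.7
  [Cohen1993].
-/

noncomputable section

namespace Literature.Algebra.EuclideanLattices

open Finset Literature.Computability.QuantumComplexity

namespace Babai

/-! ### Back-substitution on `ℕ`-indexed data -/

/-- **Back-substitution, list form**: data `lamB i j = Λⱼ(bᵢ)`, `lamW j = Λⱼ(w)`, `d j = d_{j+1}` indexed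
by naturals; output the list `[z₀, …, z_{k-1}]` (top coefficient computed first, target row updated
linearly). [cite: Babai1986, §3; Cohen1993, Algorithm 2.6.7] -/
def backSubL : ℕ → (ℕ → ℕ → ℤ) → (ℕ → ℤ) → (ℕ → ℤ) → List ℤ
  | 0, _, _, _ => []
  | k + 1, lamB, lamW, d =>
      let z : ℤ := roundDiv (lamW k) (d k)
      backSubL k lamB (fun j => lamW j - z * lamB k j) d ++ [z]

/-- Unfolding of one step. [folklore] -/
theorem backSubL_succ (k : ℕ) (lamB : ℕ → ℕ → ℤ) (lamW d : ℕ → ℤ) :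
    backSubL (k + 1) lamB lamW d =
      backSubL k lamB (fun j => lamW j - roundDiv (lamW k) (d k) * lamB k j) d ++ [roundDiv (lamW k) (d k)] := rfl

/-- The output has `k` entries. [folklore] -/
theorem length_backSubL : ∀ (k : ℕ) (lamB : ℕ → ℕ → ℤ) (lamW d : ℕ → ℤ), (backSubL k lamB lamW d).length = k
  | 0, _, _, _ => rfl
  | k + 1, lamB, lamW, d => by
      rw [backSubL_succ, List.length_append, length_backSubL, List.length_singleton]

/-- **The list form lists `intBackSub`** (data agreeing on the indices `< n`). [folklore] -/
theorem backSubL_eq_ofFn_intBackSub : ∀ (n : ℕ) (lamB : Fin n → Fin n → ℤ) (lamW d : Fin n → ℤ)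
    (LB : ℕ → ℕ → ℤ) (LW LD : ℕ → ℤ) (_ : ∀ i j : Fin n, LB i j = lamB i j) (_ : ∀ j : Fin n, LW j = lamW j)
    (_ : ∀ j : Fin n, LD j = d j),
    backSubL n LB LW LD = List.ofFn (intBackSub n lamB lamW d)
  | 0, _, _, _, _, _, _, _, _, _ => by simp [backSubL]
  | n + 1, lamB, lamW, d, LB, LW, LD, hB, hW, hd => by
      have hz : roundDiv (LW n) (LD n) = roundDiv (lamW (Fin.last n)) (d (Fin.last n)) := by
        rw [← hW (Fin.last n), ← hd (Fin.last n)]; rfl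
      rw [backSubL_succ, intBackSub_succ, List.ofFn_succ', List.concat_eq_append, hz]
      simp only [Fin.snoc_castSucc, Fin.snoc_last]
      congr 1
      refine backSubL_eq_ofFn_intBackSub n _ _ _ LB _ LD (fun i j => ?_) (fun j => ?_) (fun j => ?_)
      · exact hB (Fin.castSucc i) (Fin.castSucc j)
      · show LW j - _ * LB n j = lamW (Fin.castSucc j) - _ * lamB (Fin.last n) (Fin.castSucc j)
        rw [← hW (Fin.castSucc j), ← hB (Fin.last n) (Fin.castSucc j)]
        rfl
      · exact hd (Fin.castSucc j)

/-! ### The program on rows -/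

/-- **Babai's coefficients of `w` with respect to `rows`, from ONE Cohen table of the extended rows**
`rows ++ [w]` (`n = |rows|` columns, levels `0, …, n`): `lamB i j = T_j(i,j)`, `lamW j = T_j(n,j)`,
`d j = d_{j+1}`. [cite: Babai1986, §3; Cohen1993, Algorithm 2.6.7] -/
def coeffsL (rows : List (List ℤ)) (w : List ℤ) : List ℤ :=
  backSubL rows.length
    (fun i j => tabEntry (tableRec (rows ++ [w]) rows.length j) i j)
    (fun j => tabEntry (tableRec (rows ++ [w]) rows.length j) rows.length j)
    (fun j => dList (rows ++ [w]) rows.length (j + 1))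

/-- `coeffsL` has one coefficient per row. [folklore] -/
theorem length_coeffsL (rows : List (List ℤ)) (w : List ℤ) : (coeffsL rows w).length = rows.length :=
  length_backSubL _ _ _ _

/-- **Babai's residual as a list**: coordinate `t < m` is `w_t - ∑ᵢ zᵢ · rows[i]_t` (`dotZ` of the
coefficient list with column `t`). [cite: Babai1986, §3] -/
def residualL (rows : List (List ℤ)) (w : List ℤ) (m : ℕ) : List ℤ :=
  (List.range m).map fun t => w.getD t 0 - dotZ (coeffsL rows w) (rows.map fun r => r.getD t 0)

/-- `residualL` has `m` coordinates. [folklore] -/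
theorem length_residualL (rows : List (List ℤ)) (w : List ℤ) (m : ℕ) : (residualL rows w m).length = m := by
  simp [residualL]

/-! ### Agreement with the `Fin`-indexed algorithm on `ofFn` rows -/

variable {n m : ℕ}

/-- The extended rows of `ofFn` data are the `ofFn` rows of the extended family. [folklore] -/
theorem ofFn_rows_append (b : Fin n → (Fin m → ℤ)) (w : Fin m → ℤ) :
    (List.ofFn fun i => List.ofFn (b i)) ++ [List.ofFn w] =
      List.ofFn fun i => List.ofFn ((Fin.snoc b w : Fin (n + 1) → (Fin m → ℤ)) i) := by
  rw [List.ofFn_succ' (fun i => List.ofFn ((Fin.snoc b w : Fin (n + 1) → (Fin m → ℤ)) i)),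
    List.concat_eq_append]
  simp only [Fin.snoc_castSucc, Fin.snoc_last]

/-- **On `ofFn` rows of a linearly independent family the program computes `intNearestPlane`.**
[cite: Babai1986, §3; Cohen1993, Algorithm 2.6.7] -/
theorem coeffsL_ofFn (b : Fin n → (Fin m → ℤ)) (w : Fin m → ℤ) (hli : LinearIndependent ℝ (rowsR b)) :
    coeffsL (List.ofFn fun i => List.ofFn (b i)) (List.ofFn w) = List.ofFn (intNearestPlane n b w) := by
  rw [← intBackSub_uRec_eq_intNearestPlane b w hli, coeffsL]
  have hlen : (List.ofFn fun i => List.ofFn (b i)).length = n := List.length_ofFn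
  rw [ofFn_rows_append, hlen]
  have hmin : min n (n + 1) = n := Nat.min_eq_left (Nat.le_succ n)
  refine backSubL_eq_ofFn_intBackSub n _ _ _ _ _ _ (fun i j => ?_) (fun j => ?_) (fun j => ?_)
  · exact tabEntry_tableRec_ofFn (Fin.snoc b w : Fin (n + 1) → (Fin m → ℤ)) (C := n) (l := j)
      (by rw [hmin]; exact (le_of_lt j.isLt)) (Fin.castSucc i) (j := j) (by rw [hmin]; exact j.isLt)
  · exact tabEntry_tableRec_ofFn (Fin.snoc b w : Fin (n + 1) → (Fin m → ℤ)) (C := n) (l := j)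
      (by rw [hmin]; exact (le_of_lt j.isLt)) (Fin.last n) (j := j) (by rw [hmin]; exact j.isLt)
  · exact dList_ofFn (Fin.snoc b w : Fin (n + 1) → (Fin m → ℤ)) (C := n) (l := j + 1) (by rw [hmin]; omega)

/-- The truncating dot product with column `t` of `ofFn` rows is the sum `∑ᵢ zᵢ bᵢ(t)`. [folklore] -/
theorem dotZ_ofFn_column (z : Fin n → ℤ) (b : Fin n → (Fin m → ℤ)) (t : Fin m) :
    dotZ (List.ofFn z) ((List.ofFn fun i => List.ofFn (b i)).map fun r => r.getD t 0) = ∑ i, z i * b i t := by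
  rw [dotZ_eq_sum (D := n) _ _ (by simp) (by simp)]
  refine Finset.sum_congr rfl fun i _ => ?_
  simp [List.getD_eq_getElem?_getD]

/-- **On `ofFn` rows of a linearly independent family the program computes `intResidual`.**
[cite: Babai1986, §3] -/
theorem residualL_ofFn (b : Fin n → (Fin m → ℤ)) (w : Fin m → ℤ) (hli : LinearIndependent ℝ (rowsR b)) :
    residualL (List.ofFn fun i => List.ofFn (b i)) (List.ofFn w) m = List.ofFn (intResidual b w) := by
  refine List.ext_getElem (by simp [residualL]) fun t h₁ h₂ => ?_
  have ht : t < m := by simpa [residualL] using h₁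
  have lhs : (residualL (List.ofFn fun i => List.ofFn (b i)) (List.ofFn w) m)[t] =
      (List.ofFn w).getD t 0 - dotZ (coeffsL (List.ofFn fun i => List.ofFn (b i)) (List.ofFn w))
        ((List.ofFn fun i => List.ofFn (b i)).map fun r => r.getD t 0) := by
    simp [residualL]
  rw [lhs, List.getElem_ofFn, coeffsL_ofFn b w hli, dotZ_ofFn_column _ b ⟨t, ht⟩]
  have hw : (List.ofFn w).getD t 0 = w ⟨t, ht⟩ := by
    simp [List.getD_eq_getElem?_getD, ht]
  rw [hw]
  simp only [intResidual, Pi.sub_apply, Finset.sum_apply, Pi.smul_apply, smul_eq_mul]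

end Babai

end Literature.Algebra.EuclideanLattices

end
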